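import Mathlib.Analysis.SpecialFunctions.Exp
import HarnessLib

/-!
# `ConvergentOSClosure` (crux stmt-QuantumFields-11525), stub `stub_speciesDiagClustering` —
# negative-side support: per-pair eventual bounds do NOT transfer to `k`-growing families of pairs

Support file (lead `prover-line-stmt-QuantumFields-11525-0`, stub worker S3) recording, over Mathlib only,
the abstract quantifier obstruction met by every proof of the registered stub

  `… → sch.HasLatticeMassGap Δ → (convergence on off-diagonal real tensors) → sch.HasSpeciesDiagClustering Δ`.

DICTIONARY.  The hypothesis `QCDScheme.HasLatticeMassGap Δ` (`QCDOS.lean`) has the shape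
`∀ (A, B), ∃ C, ∀ᶠ k, … ≤ C e^{−Δ a_k n}` — one constant AND one threshold per FIXED pair of
gauge-invariant local lattice observables.  The conclusion `ClustersDiag 4 (qcdLatticeSchwinger sch) Δ`
bounds, eventually in `k` with slack `ε`, the truncated `2n`-point function of the SMEARED renormalised
species fields `Φ_k^s(f) = z_s(k) a_k⁴ ∑_{x ∈ box} f(a_k x) (O_s(x) − shift_s(k))`; by translation
covariance it is a normalised (Riemann) sum `∑_v a_k⁴ h(a_k v − t e₀) · [z(k)² G_k(v)]` over the lattice
offsets `v` between the insertion patterns — a family of ≍ `a_k⁻⁴ · |supp h|` DISTINCT pairs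
`(O, τ_v O)` (for `n ≥ 2` legs: distinct product patterns), growing with `k`, each with its own
`(C_v, k₀(v))`.  Below, the index `j ≤ k` stands for the offset / pattern `v`, the weight `1/(k+1)` for
the Riemann weight `a_k⁴ h(a_k v)`, `t` for the physical time separation and `e^{−t}` for `e^{−Δt}`.

* `perPair_not_transfer_to_growing_family` — ONE witness family `c k j t` (only the newest member
  `j = k` of the step-`k` family is non-zero, of size `(k+1)² e^{−t}`) satisfies SIMULTANEOUSLY
  (i) non-negativity, (ii) the per-index-threshold hypothesis in its strongest form (each member is
  eventually IDENTICALLY zero — defect D2 of the census of the Yang–Mills twin stmt-8896),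
  (iii) the uniform-threshold / per-index-constant hypothesis (defect D3: `k₀ = 0`, `C_j = (j+1)²`),
  (iv) a `j`-uniform bound at each FIXED `k` (what eventual boundedness of each fixed lattice quantity,
  i.e. the convergence hypothesis of the stub, adds) — and yet its normalised family averages
  `(k+1) e^{−t}` violate the `ClustersDiag`-shaped conclusion `∃ C ∀ t ∀ ε ∀ᶠ k, avg ≤ C e^{−t} + ε` at
  EVERY `t` and EVERY slack `ε`.
* `perPairShape_not_transfer` — the bare shape asked for in the stub brief:
  `¬ ∀ c, (∀ j, ∃ C, ∀ᶠ k, |c k j| ≤ C) → ∃ C, ∀ᶠ k, |∑_{j<k} c k j| ≤ C`.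
* `uniform_transfers` — what DOES transfer (the shape a corrected lattice hypothesis must have): ONE
  constant valid for ALL members from ONE threshold on passes to every normalised average.

Companion of `LatticeGapOnTrajectory.Negative.perPair_clustering_does_not_transfer` (p114724; per-`k`
constants of ONE pair do not pass to the `k → ∞` limit) — that witness concerns a fixed pair along `k`,
this one the `k`-growing family at fixed `k`; neither uses any project definition.
`lean check`: rc 0, 0 sorries.
-/

namespace Summit.QuantumFields.QCD.Theorems.ConvergentOSClosure.Negative

open Filter Finset

/-- **Per-pair eventual bounds do not control `k`-growing families of pairs.**  The family
`c k j t = (k+1)² e^{−t}` if `j = k`, `0` otherwise, is non-negative; every FIXED member `j` is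
eventually (for `k ≥ j+1`) identically zero (per-index threshold, any constant); every member obeys
`c k j t ≤ (j+1)² e^{−t}` for ALL `k` (threshold `0`, per-index constant); at every fixed `k` all members
obey one bound `(k+1)² e^{−t}`; but the normalised average over the step-`k` family,
`(∑_{j ≤ k} c k j t)/(k+1) = (k+1) e^{−t}`, admits no bound `C e^{−t} + ε` eventually in `k`, for any
`C`, any `t` and any slack `ε`. [folklore] -/
theorem perPair_not_transfer_to_growing_family :
    ∃ c : ℕ → ℕ → ℝ → ℝ,
      (∀ k j t, 0 ≤ c k j t) ∧
      (∀ j, ∀ᶠ k in atTop, ∀ t, c k j t = 0) ∧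
      (∀ j, ∃ C : ℝ, ∀ k t, c k j t ≤ C * Real.exp (-t)) ∧
      (∀ k, ∃ C : ℝ, ∀ j t, c k j t ≤ C * Real.exp (-t)) ∧
      ∀ (C t ε : ℝ), ¬ ∀ᶠ k in atTop,
        (∑ j ∈ Finset.range (k + 1), c k j t) / (k + 1) ≤ C * Real.exp (-t) + ε := by
  refine ⟨fun k j t => if j = k then ((k : ℝ) + 1) ^ 2 * Real.exp (-t) else 0,
    ?_, ?_, ?_, ?_, ?_⟩
  · -- (i) non-negativity
    intro k j t
    dsimp only
    split_ifs
    · positivity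
    · exact le_rfl
  · -- (ii) each fixed member is eventually identically zero
    intro j
    filter_upwards [eventually_gt_atTop j] with k hk t
    rw [if_neg (Nat.ne_of_gt hk).symm]
  · -- (iii) threshold `0`, per-index constant `(j+1)²`
    intro j
    refine ⟨((j : ℝ) + 1) ^ 2, fun k t => ?_⟩
    dsimp only
    split_ifs with h
    · subst h; exact le_rfl
    · positivity
  · -- (iv) at fixed `k`, one bound for all members
    intro k
    refine ⟨((k : ℝ) + 1) ^ 2, fun j t => ?_⟩
    dsimp only
    split_ifs
    · exact le_rfl
    · positivity
  · -- (v) the normalised averages `(k+1) e^{-t}` escape every `C e^{-t} + ε`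
    intro C t ε hev
    have havg : ∀ k : ℕ, (∑ j ∈ Finset.range (k + 1),
        (if j = k then ((k : ℝ) + 1) ^ 2 * Real.exp (-t) else 0)) / (k + 1) =
        ((k : ℝ) + 1) * Real.exp (-t) := by
      intro k
      have hk : (k : ℝ) + 1 ≠ 0 := by positivity
      rw [Finset.sum_ite_eq' (Finset.range (k + 1)) k, if_pos (Finset.self_mem_range_succ k),
        pow_two, mul_assoc, mul_div_cancel_left₀ _ hk]
    have hev' : ∀ᶠ k : ℕ in atTop, ((k : ℝ) + 1) * Real.exp (-t) ≤ C * Real.exp (-t) + ε :=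
      hev.mono fun k hk => by rwa [havg k] at hk
    -- but `(k+1) e^{-t} → +∞`
    have hdiv : Tendsto (fun k : ℕ => ((k : ℝ) + 1) * Real.exp (-t)) atTop atTop :=
      (tendsto_atTop_add_const_right atTop 1 tendsto_natCast_atTop_atTop).atTop_mul_const
        (Real.exp_pos (-t))
    obtain ⟨k, hk₁, hk₂⟩ := (hev'.and (hdiv.eventually_gt_atTop (C * Real.exp (-t) + ε))).exists
    exact absurd hk₁ (not_le.mpr hk₂)

/-- **The bare shape of the stub brief**: "per-index eventually bounded ⇒ eventually bounded sums over
the `k`-growing index range" is false (witness `c ≡ 1`: every member is bounded by `1` from `k = 0` on,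
the sums are `k`). [folklore] -/
theorem perPairShape_not_transfer :
    ¬ (∀ (c : ℕ → ℕ → ℝ), (∀ j, ∃ C : ℝ, ∀ᶠ k in atTop, |c k j| ≤ C) →
        ∃ C : ℝ, ∀ᶠ k in atTop, |∑ j ∈ Finset.range k, c k j| ≤ C) := by
  intro h
  obtain ⟨C, hC⟩ := h (fun _ _ => 1) fun _ => ⟨1, Eventually.of_forall fun _ => by simp⟩
  have hev : ∀ᶠ k : ℕ in atTop, (k : ℝ) ≤ C := hC.mono fun k hk => by simpa using hk
  obtain ⟨k, hk₁, hk₂⟩ := (hev.and (tendsto_natCast_atTop_atTop.eventually_gt_atTop C)).exists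
  exact absurd hk₁ (not_le.mpr hk₂)

/-- **What does transfer** (the shape a corrected lattice hypothesis must have): if ONE constant `C`
bounds ALL members of the step-`k` family from ONE threshold on, `|c k j t| ≤ C e^{−t}` for all `j`,
then every average with non-negative weights of total mass `≤ 1` obeys `≤ C e^{−t}` (hence
`≤ C e^{−t} + ε`) from the same threshold on. [folklore] -/
theorem uniform_transfers (c : ℕ → ℕ → ℝ → ℝ) (w : ℕ → ℕ → ℝ) (N : ℕ → ℕ)
    (hw : ∀ k j, 0 ≤ w k j) (hw1 : ∀ k, ∑ j ∈ Finset.range (N k), w k j ≤ 1) {C : ℝ} (hC : 0 ≤ C)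
    (h : ∀ᶠ k in atTop, ∀ j t, 0 ≤ t → |c k j t| ≤ C * Real.exp (-t)) :
    ∀ t : ℝ, 0 ≤ t → ∀ ε : ℝ, 0 < ε → ∀ᶠ k in atTop,
      |∑ j ∈ Finset.range (N k), w k j * c k j t| ≤ C * Real.exp (-t) + ε := by
  intro t ht ε hε
  filter_upwards [h] with k hk
  have hCe : 0 ≤ C * Real.exp (-t) := mul_nonneg hC (Real.exp_pos _).le
  calc |∑ j ∈ Finset.range (N k), w k j * c k j t|
      ≤ ∑ j ∈ Finset.range (N k), |w k j * c k j t| := Finset.abs_sum_le_sum_abs _ _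
    _ ≤ ∑ j ∈ Finset.range (N k), w k j * (C * Real.exp (-t)) := by
        refine Finset.sum_le_sum fun j _ => ?_
        rw [abs_mul, abs_of_nonneg (hw k j)]
        exact mul_le_mul_of_nonneg_left (hk j t ht) (hw k j)
    _ = (∑ j ∈ Finset.range (N k), w k j) * (C * Real.exp (-t)) := (Finset.sum_mul _ _ _).symm
    _ ≤ 1 * (C * Real.exp (-t)) := mul_le_mul_of_nonneg_right (hw1 k) hCe
    _ ≤ C * Real.exp (-t) + ε := by linarith

end Summit.QuantumFields.QCD.Theorems.ConvergentOSClosure.Negative
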